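import Summits.AtomisticToContinuum.Crystallization.Theorems.ReggeStarCoercivityDefectFreeCrystallizesFunnelSitesCovariance
import HarnessLib

/-!
# Route `ReggeStarCoercivity`, crux `DefectFreeCrystallizes` (stmt-AtomisticToContinuum-13603), line `palm-good-law`
# (skeleton v24, stub S2 `stub_rootCubicCount`): THE CUBIC NEIGHBOURS OF A CHARTED SITE

**Theorem** (`stub_rootCubicCount`).  Let `(s, Φ)` be a funnel chart of a configuration `S ⊆ ℝ³`: `s` a Hägg
word, `Φ` a bijection from the unit ideal Barlow stacking `barlowStacking 1 √(2/3) s` onto `S` carrying the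
touching pairs (`dist = 1`) exactly onto the bonds of `S` (pairs at distance in the open window `(0, 6/5)`,
`FunnelSites.Bond65`).  Then for every lattice site `(k, i, j)` the set of CUBIC bonded neighbours of the root
`x = Φ (barlowPos 1 √(2/3) s k i j)` is finite and has exactly
`6·[s k = s (k−1)] + 3·[s (k+1) = s k] + 3·[s (k−1) = s (k−2)]` elements.

**Proof.**  The bonded neighbours of `x` are the chart images of the twelve lattice neighbours of `(k, i, j)`,
whose offsets are listed by the finite shell model `shellOffsets (s (k-1)) (s k)` of crux 9226
(`mem_shellOffsets_of_dist_eq_one`; conversely every listed offset touches the root,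
`dist_eq_one_iff_shellAdj` plus a `decide`), six in layer `k`, three in layer `k + 1`, three in layer
`k - 1`; and the image of a site of layer `k'` is cubic iff `s k' = s (k' - 1)`
(`FunnelSites.isCubicSite65_chart_iff`).  So the set is the image of the offsets `o` with
`s (k + o.1) = s (k + o.1 - 1)` under the injective map `o ↦ Φ (barlowPos 1 √(2/3) s (k + o.1) (i + o.2.1) (j + o.2.2))`
(`Φ` is injective on the stacking and distinct index triples are distinct points, `le_dist_barlowPos`), and
the count is a finite check on the explicit twelve-element list.  All `[folklore]`.
-/

noncomputable section

namespace Summit.AtomisticToContinuum.Crystallization.Theorems.PalmGoodLaw.RootCubicCount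

open Literature.MathematicalPhysics.StatisticalMechanics
open Summit.AtomisticToContinuum.Crystallization.Theorems.PalmUnimodularRigidity.LayeredLawsSelectHcp
  (fst_of_mem_shellOffsets dist_eq_one_iff_shellAdj mem_shellOffsets_of_dist_eq_one ShellAdj shellOffsets)

/-! ## The finite shell model: the root touches its twelve offsets; counting offsets by layer -/

/-- Every offset of the shell model touches the root offset `(0, 0, 0)` (a finite check). [folklore] -/
theorem shellAdj_zero_of_mem {σ₁ σ₂ : ℤ} (h₁ : σ₁ = 1 ∨ σ₁ = -1) (h₂ : σ₂ = 1 ∨ σ₂ = -1) :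
    ∀ o ∈ shellOffsets σ₁ σ₂, ShellAdj σ₁ σ₂ (0, 0, 0) o := by
  rcases h₁ with rfl | rfl <;> rcases h₂ with rfl | rfl <;> decide

/-- **Counting offsets by layer.**  A predicate on the shell model that only depends on the layer offset
`o.1 ∈ {-1, 0, 1}` — true on layer `0` iff `c0`, on layer `1` iff `cp`, on layer `-1` iff `cm` — selects
`6·[c0] + 3·[cp] + 3·[cm]` of the twelve offsets (six in the layer, three above, three below; a finite
check). [folklore] -/
theorem card_filter_shellOffsets {σ₁ σ₂ : ℤ} (h₁ : σ₁ = 1 ∨ σ₁ = -1) (h₂ : σ₂ = 1 ∨ σ₂ = -1)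
    (P : ℤ × ℤ × ℤ → Prop) [DecidablePred P] (c0 cp cm : Bool)
    (hP : ∀ o ∈ shellOffsets σ₁ σ₂,
      P o ↔ (o.1 = 0 ∧ c0 = true ∨ o.1 = 1 ∧ cp = true ∨ o.1 = -1 ∧ cm = true)) :
    ((shellOffsets σ₁ σ₂).toFinset.filter P).card =
      6 * (if c0 = true then 1 else 0) + 3 * (if cp = true then 1 else 0) +
        3 * (if cm = true then 1 else 0) := by
  rw [Finset.filter_congr (fun o ho => hP o (List.mem_toFinset.1 ho))]
  rcases h₁ with rfl | rfl <;> rcases h₂ with rfl | rfl <;> cases c0 <;> cases cp <;> cases cm <;>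
    decide

/-! ## The unit ideal stacking: index injectivity -/

/-- Distinct index triples of the unit ideal stacking are distinct points (uniform discreteness
`le_dist_barlowPos`: distinct triples are at distance `≥ min 1 √(2/3) > 0`). [folklore] -/
theorem barlowPos_idx_inj {s : ℤ → ℤ} {k i j k' i' j' : ℤ}
    (h : barlowPos 1 (Real.sqrt (2 / 3)) s k i j = barlowPos 1 (Real.sqrt (2 / 3)) s k' i' j') :
    k = k' ∧ i = i' ∧ j = j' := by
  by_contra hne
  have hne' : (k, i, j) ≠ (k', i', j') := fun e => by
    simp only [Prod.mk.injEq] at e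
    exact hne e
  have hle := le_dist_barlowPos 1 (Real.sqrt (2 / 3)) s zero_le_one (Real.sqrt_nonneg _) hne'
  rw [h, dist_self] at hle
  have hpos : (0 : ℝ) < min 1 (Real.sqrt (2 / 3)) := lt_min one_pos (Real.sqrt_pos.2 (by norm_num))
  linarith

/-! ## Through a funnel chart: the cubic bonded neighbours of a charted site -/

section Chart

variable {s : ℤ → ℤ} {S : Set (EuclideanSpace ℝ (Fin 3))}
  {Φ : EuclideanSpace ℝ (Fin 3) → EuclideanSpace ℝ (Fin 3)}

/-- The chart image of the lattice site at offset `o` from `(k, i, j)` is an injective function of the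
offset (`Φ` is injective on the stacking, `barlowPos_idx_inj`). [folklore] -/
theorem chart_offset_injective (hbij : Set.BijOn Φ (barlowStacking 1 (Real.sqrt (2 / 3)) s) S)
    (k i j : ℤ) :
    Function.Injective (fun o : ℤ × ℤ × ℤ =>
      Φ (barlowPos 1 (Real.sqrt (2 / 3)) s (k + o.1) (i + o.2.1) (j + o.2.2))) := by
  rintro ⟨dk, di, dj⟩ ⟨dk', di', dj'⟩ h
  dsimp only at h
  obtain ⟨e1, e2, e3⟩ :=
    barlowPos_idx_inj (hbij.injOn (barlowPos_mem _ _ _) (barlowPos_mem _ _ _) h)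
  simp only [Prod.mk.injEq]
  omega

/-- **The cubic bonded neighbours of a charted site are the chart images of the cubic offsets of its
shell**: under a funnel chart `(s, Φ)` the set of cubic bonded neighbours of `Φ (barlowPos 1 √(2/3) s k i j)`
is the image under `o ↦ Φ (barlowPos 1 √(2/3) s (k + o.1) (i + o.2.1) (j + o.2.2))` of the offsets
`o ∈ shellOffsets (s (k-1)) (s k)` with `s (k + o.1) = s (k + o.1 - 1)` (`mem_shellOffsets_of_dist_eq_one`,
`dist_eq_one_iff_shellAdj`, `FunnelSites.bond65_chart_iff`, `FunnelSites.isCubicSite65_chart_iff`).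
[folklore] -/
theorem cubicNeighbours_eq_image (hs : IsHaggSeq s)
    (hbij : Set.BijOn Φ (barlowStacking 1 (Real.sqrt (2 / 3)) s) S)
    (hiso : ∀ p ∈ barlowStacking 1 (Real.sqrt (2 / 3)) s, ∀ q ∈ barlowStacking 1 (Real.sqrt (2 / 3)) s,
      (dist p q = 1 ↔ (0 < dist (Φ p) (Φ q) ∧ dist (Φ p) (Φ q) < 6 / 5)))
    (k i j : ℤ) :
    {y : EuclideanSpace ℝ (Fin 3) | FunnelSites.Bond65 S (Φ (barlowPos 1 (Real.sqrt (2 / 3)) s k i j)) y ∧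
        FunnelSites.IsCubicSite65 S y} =
      (fun o : ℤ × ℤ × ℤ => Φ (barlowPos 1 (Real.sqrt (2 / 3)) s (k + o.1) (i + o.2.1) (j + o.2.2))) ''
        ↑((shellOffsets (s (k - 1)) (s k)).toFinset.filter
          fun o : ℤ × ℤ × ℤ => s (k + o.1) = s (k + o.1 - 1)) := by
  ext y
  simp only [Set.mem_setOf_eq, Set.mem_image, Finset.coe_filter, List.mem_toFinset]
  constructor
  · rintro ⟨hb, hc⟩
    -- pull the neighbour back to a lattice site
    obtain ⟨p, hpB, rfl⟩ := hbij.surjOn hb.2.1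
    obtain ⟨k', i', j', rfl⟩ := hpB
    rw [FunnelSites.bond65_chart_iff hbij hiso] at hb
    rw [FunnelSites.isCubicSite65_chart_iff hs hbij hiso] at hc
    have ho := mem_shellOffsets_of_dist_eq_one hs hb
    refine ⟨(k' - k, i' - i, j' - j), ⟨ho, ?_⟩, ?_⟩
    · have e1 : k + (k' - k) = k' := by omega
      rw [e1]
      exact hc
    · have e1 : k + (k' - k) = k' := by omega
      have e2 : i + (i' - i) = i' := by omega
      have e3 : j + (j' - j) = j' := by omega
      rw [e1, e2, e3]
  · rintro ⟨⟨dk, di, dj⟩, ⟨ho, hP⟩, rfl⟩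
    have hdk : dk = -1 ∨ dk = 0 ∨ dk = 1 := fst_of_mem_shellOffsets ho
    refine ⟨?_, (FunnelSites.isCubicSite65_chart_iff hs hbij hiso _ _ _).2 hP⟩
    rw [FunnelSites.bond65_chart_iff hbij hiso,
      dist_eq_one_iff_shellAdj s k i j (k₁ := k) (k₂ := k + dk) (by omega) (by omega)]
    have e0 : k - k = 0 := sub_self k
    have e0' : i - i = 0 := sub_self i
    have e0'' : j - j = 0 := sub_self j
    have e1 : k + dk - k = dk := by omega
    have e2 : i + di - i = di := by omega
    have e3 : j + dj - j = dj := by omega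
    rw [e0, e0', e0'', e1, e2, e3]
    exact shellAdj_zero_of_mem (hs (k - 1)) (hs k) _ ho

/-- **S2 `stub_rootCubicCount` (registered, skeleton v24 of line `palm-good-law`).**  THE CUBIC NEIGHBOURS OF A
CHARTED SITE: under a funnel chart `(s, Φ)` (bond window `(0, 6/5)`) the bonded neighbours of
`x = Φ (barlowPos 1 √(2/3) s k i j)` are the chart images of the twelve lattice neighbours
(`mem_shellOffsets_of_dist_eq_one`, `dist_eq_one_iff_shellAdj`, `shellOffsets`: six in layer `k`, three in
layer `k+1`, three in layer `k−1`; `FunnelSites.bond65_chart_iff`), and the image of a site of layer `k'` is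
cubic iff `s k' = s (k'−1)` (`FunnelSites.isCubicSite65_chart_iff`).  Hence the set of cubic bonded
neighbours of `x` is finite and has exactly `6·[s k = s (k−1)] + 3·[s (k+1) = s k] + 3·[s (k−1) = s (k−2)]`
elements (`cubicNeighbours_eq_image`, `chart_offset_injective`, `card_filter_shellOffsets`). [folklore] -/
theorem stub_rootCubicCount :
    ∀ (s : ℤ → ℤ) (S : Set (EuclideanSpace ℝ (Fin 3))) (Φ : EuclideanSpace ℝ (Fin 3) → EuclideanSpace ℝ (Fin 3)),
      IsHaggSeq s → Set.BijOn Φ (barlowStacking 1 (Real.sqrt (2 / 3)) s) S →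
      (∀ p ∈ barlowStacking 1 (Real.sqrt (2 / 3)) s, ∀ q ∈ barlowStacking 1 (Real.sqrt (2 / 3)) s,
        (dist p q = 1 ↔ (0 < dist (Φ p) (Φ q) ∧ dist (Φ p) (Φ q) < 6 / 5))) →
      ∀ k i j : ℤ,
        {y : EuclideanSpace ℝ (Fin 3) | FunnelSites.Bond65 S (Φ (barlowPos 1 (Real.sqrt (2 / 3)) s k i j)) y ∧
            FunnelSites.IsCubicSite65 S y}.Finite ∧
        {y : EuclideanSpace ℝ (Fin 3) | FunnelSites.Bond65 S (Φ (barlowPos 1 (Real.sqrt (2 / 3)) s k i j)) y ∧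
            FunnelSites.IsCubicSite65 S y}.ncard =
          6 * (if s k = s (k - 1) then 1 else 0) + 3 * (if s (k + 1) = s k then 1 else 0) +
            3 * (if s (k - 1) = s (k - 2) then 1 else 0) := by
  intro s S Φ hs hbij hiso k i j
  rw [cubicNeighbours_eq_image hs hbij hiso k i j]
  refine ⟨(Finset.finite_toSet _).image _, ?_⟩
  rw [(chart_offset_injective hbij k i j).injOn.ncard_image, Set.ncard_coe_finset]
  -- the predicate only depends on the layer offset
  have hP : ∀ o ∈ shellOffsets (s (k - 1)) (s k),
      (fun o : ℤ × ℤ × ℤ => s (k + o.1) = s (k + o.1 - 1)) o ↔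
        (o.1 = 0 ∧ decide (s k = s (k - 1)) = true ∨ o.1 = 1 ∧ decide (s (k + 1) = s k) = true ∨
          o.1 = -1 ∧ decide (s (k - 1) = s (k - 2)) = true) := by
    rintro ⟨dk, di, dj⟩ ho
    simp only [decide_eq_true_eq]
    rcases fst_of_mem_shellOffsets ho with rfl | rfl | rfl
    · have e1 : s (k + -1 - 1) = s (k - 2) := congrArg s (by omega)
      have e2 : s (k + -1) = s (k - 1) := congrArg s (by omega)
      rw [e1, e2]
      omega
    · have e1 : s (k + 0 - 1) = s (k - 1) := congrArg s (by omega)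
      have e2 : s (k + 0) = s k := congrArg s (by omega)
      rw [e1, e2]
      omega
    · have e1 : s (k + 1 - 1) = s k := congrArg s (by omega)
      rw [e1]
      omega
  have h := card_filter_shellOffsets (hs (k - 1)) (hs k)
    (fun o : ℤ × ℤ × ℤ => s (k + o.1) = s (k + o.1 - 1)) (decide (s k = s (k - 1)))
    (decide (s (k + 1) = s k)) (decide (s (k - 1) = s (k - 2))) hP
  simp only [decide_eq_true_eq] at h
  exact h

end Chart

end Summit.AtomisticToContinuum.Crystallization.Theorems.PalmGoodLaw.RootCubicCount

end
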